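import Mathlib.Analysis.Convolution
import Mathlib.Analysis.Fourier.Convolution
import Mathlib.Analysis.Fourier.FourierTransform
import Mathlib.MeasureTheory.Integral.Bochner.Basic
import HarnessLib

/-!
# Ground-state endgame, XI: convolution powers of a bump

Solo programme `solo-RiemannHypothesis-informed`, session 2 (claim C28). Elementary toolkit: the
`(n+1)`-fold additive autoconvolution `cpow φ n` of a continuous compactly supported `φ : ℝ → ℝ` —
continuity, compact support with the explicit radius `(n+1) r`, non-negativity, mass
`(∫ φ)^{n+1}`, evenness, and the Fourier transform `(𝓕 φ)^{n+1}`. This is the B-spline-type kernel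
whose Fourier transform at frequency `≍ n` is exponentially small in `n` while its support has
radius `O(n r)`; rescaled by `n` it is the λ-dependent smoothing of the seed in part XII.
-/

noncomputable section

open MeasureTheory Set Filter Topology Convolution ContinuousLinearMap
open scoped FourierTransform

namespace Summit.RiemannHypothesis.RiemannHypothesis.Theorems

/-- The `(n+1)`-fold autoconvolution: `cpow φ 0 = φ`, `cpow φ (n+1) = φ ⋆ cpow φ n`. -/
def cpow (φ : ℝ → ℝ) : ℕ → ℝ → ℝ
  | 0 => φ
  | n + 1 => φ ⋆[lsmul ℝ ℝ, volume] cpow φ n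

/-- Unfolding the successor. -/
theorem cpow_succ (φ : ℝ → ℝ) (n : ℕ) : cpow φ (n + 1) = φ ⋆[lsmul ℝ ℝ, volume] cpow φ n := rfl

/-- `cpow φ 0 = φ`. -/
@[simp] theorem cpow_zero (φ : ℝ → ℝ) : cpow φ 0 = φ := rfl

section basic

variable {φ : ℝ → ℝ} (hc : Continuous φ) (hs : HasCompactSupport φ)
include hc hs

/-- Continuity and compact support of every convolution power. -/
theorem continuous_and_hasCompactSupport_cpow (n : ℕ) :
    Continuous (cpow φ n) ∧ HasCompactSupport (cpow φ n) := by
  induction n with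
  | zero => exact ⟨hc, hs⟩
  | succ n ih =>
    refine ⟨?_, ?_⟩
    · rw [cpow_succ]
      exact hs.continuous_convolution_left _ hc
        (ih.1.locallyIntegrable (μ := volume))
    · rw [cpow_succ]
      exact hs.convolution _ ih.2

/-- Continuity of the convolution powers. -/
theorem continuous_cpow (n : ℕ) : Continuous (cpow φ n) :=
  (continuous_and_hasCompactSupport_cpow hc hs n).1

/-- Compact support of the convolution powers. -/
theorem hasCompactSupport_cpow (n : ℕ) : HasCompactSupport (cpow φ n) :=
  (continuous_and_hasCompactSupport_cpow hc hs n).2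

/-- Integrability of the convolution powers. -/
theorem integrable_cpow (n : ℕ) : Integrable (cpow φ n) :=
  (continuous_cpow hc hs n).integrable_of_hasCompactSupport (hasCompactSupport_cpow hc hs n)

/-- Mass: `∫ cpow φ n = (∫ φ)^{n+1}`. -/
theorem integral_cpow (n : ℕ) : ∫ x, cpow φ n x = (∫ x, φ x) ^ (n + 1) := by
  induction n with
  | zero => simp
  | succ n ih =>
    rw [cpow_succ, integral_convolution (lsmul ℝ ℝ) (hc.integrable_of_hasCompactSupport hs)
      (integrable_cpow hc hs n), ih, lsmul_apply, smul_eq_mul, pow_succ, pow_succ]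
    ring

omit hc hs in
/-- Support radius: if `φ` vanishes off `[-r, r]` then `cpow φ n` vanishes off `[-(n+1)r, (n+1)r]`. -/
theorem cpow_eq_zero_of_lt {r : ℝ} (hr : ∀ x, r < |x| → φ x = 0) (n : ℕ) {x : ℝ}
    (hx : (n + 1) * r < |x|) : cpow φ n x = 0 := by
  induction n generalizing x with
  | zero => exact hr x (by simpa using hx)
  | succ n ih =>
    rw [cpow_succ, convolution_lsmul]
    refine integral_eq_zero_of_ae (Eventually.of_forall fun t => ?_)
    simp only [Pi.zero_apply, smul_eq_mul]
    rcases lt_or_ge r |t| with ht | ht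
    · rw [hr t ht, zero_mul]
    · have : (n + 1 : ℝ) * r < |x - t| := by
        have h1 : |x| - |t| ≤ |x - t| := abs_sub_abs_le_abs_sub x t
        push_cast at hx
        nlinarith
      rw [ih (by exact_mod_cast this), mul_zero]

omit hc hs in
/-- Non-negativity is preserved. -/
theorem cpow_nonneg (hφ : ∀ x, 0 ≤ φ x) (n : ℕ) (x : ℝ) : 0 ≤ cpow φ n x := by
  induction n generalizing x with
  | zero => exact hφ x
  | succ n ih =>
    rw [cpow_succ, convolution_lsmul]
    exact integral_nonneg fun t => by
      simp only [Pi.zero_apply, smul_eq_mul]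
      exact mul_nonneg (hφ t) (ih _)

omit hc hs in
/-- Evenness is preserved. -/
theorem cpow_even (hφ : ∀ x, φ (-x) = φ x) (n : ℕ) (x : ℝ) : cpow φ n (-x) = cpow φ n x := by
  induction n generalizing x with
  | zero => exact hφ x
  | succ n ih =>
    rw [cpow_succ]
    exact convolution_neg_of_neg_eq (lsmul ℝ ℝ) (Eventually.of_forall hφ)
      (Eventually.of_forall ih)

/-! ## The Fourier transform of the complexified powers -/

omit hc hs in
/-- The complexification of a real convolution is the complex convolution of the
complexifications. -/
theorem ofReal_convolution_eq {f g : ℝ → ℝ} (x : ℝ) :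
    (((f ⋆[lsmul ℝ ℝ, volume] g) x : ℝ) : ℂ)
      = ((fun t => (f t : ℂ)) ⋆[mul ℂ ℂ, volume] (fun t => (g t : ℂ))) x := by
  rw [convolution_lsmul, convolution_mul, ← integral_complex_ofReal]
  simp only [smul_eq_mul, Complex.ofReal_mul]

/-- `𝓕 (cpow φ n) = (𝓕 φ)^{n+1}` (complexified). -/
theorem fourier_cpow (n : ℕ) (ξ : ℝ) :
    𝓕 (fun x => (cpow φ n x : ℂ)) ξ = (𝓕 (fun x => (φ x : ℂ)) ξ) ^ (n + 1) := by
  induction n with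
  | zero => simp
  | succ n ih =>
    have hf : Integrable (fun x => (φ x : ℂ)) :=
      (hc.integrable_of_hasCompactSupport hs).ofReal
    have hg : Integrable (fun x => (cpow φ n x : ℂ)) := (integrable_cpow hc hs n).ofReal
    have heq : (fun x => (cpow φ (n + 1) x : ℂ))
        = (fun t => (φ t : ℂ)) ⋆[mul ℂ ℂ, volume] (fun t => (cpow φ n t : ℂ)) := by
      funext x
      rw [cpow_succ]
      exact ofReal_convolution_eq x
    rw [heq, Real.fourier_mul_convolution_eq hf hg, ih, pow_succ, pow_succ]
    ring

end basic

/-! ## Rescaling -/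

/-- The rescaled power `ψ_n(x) = (n+1) · cpow φ n ((n+1) x)`. -/
def cpowScaled (φ : ℝ → ℝ) (n : ℕ) (x : ℝ) : ℝ := (n + 1) * cpow φ n ((n + 1) * x)

section scaled

variable {φ : ℝ → ℝ} (hc : Continuous φ) (hs : HasCompactSupport φ)
include hc hs

/-- Continuity of the rescaled power. -/
theorem continuous_cpowScaled (n : ℕ) : Continuous (cpowScaled φ n) :=
  continuous_const.mul ((continuous_cpow hc hs n).comp (continuous_const.mul continuous_id))

/-- Mass one is preserved by the rescaling: `∫ ψ_n = (∫ φ)^{n+1}`. -/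
theorem integral_cpowScaled (n : ℕ) : ∫ x, cpowScaled φ n x = (∫ x, φ x) ^ (n + 1) := by
  unfold cpowScaled
  have hn : (0 : ℝ) < n + 1 := by positivity
  rw [integral_const_mul, Measure.integral_comp_mul_left (fun y => cpow φ n y) ((n : ℝ) + 1),
    integral_cpow hc hs n, smul_eq_mul, abs_of_pos (inv_pos.2 hn)]
  field_simp

omit hc hs in
/-- Support: if `φ` vanishes off `[-r, r]` then `ψ_n` vanishes off `[-r, r]` for every `n`. -/
theorem cpowScaled_eq_zero_of_lt {r : ℝ} (hr : ∀ x, r < |x| → φ x = 0) (n : ℕ) {x : ℝ}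
    (hx : r < |x|) : cpowScaled φ n x = 0 := by
  unfold cpowScaled
  have hn : (0 : ℝ) < n + 1 := by positivity
  rw [cpow_eq_zero_of_lt hr n (x := (n + 1) * x)
    (by rw [abs_mul, abs_of_pos hn]; exact mul_lt_mul_of_pos_left hx hn), mul_zero]

omit hc hs in
/-- Compact support of the rescaled power (radius `r` if `φ` has radius `r`). -/
theorem hasCompactSupport_cpowScaled {r : ℝ} (hr : ∀ x, r < |x| → φ x = 0) (n : ℕ) :
    HasCompactSupport (cpowScaled φ n) :=
  HasCompactSupport.intro (K := Icc (-|r|) |r|) isCompact_Icc fun x hx =>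
    cpowScaled_eq_zero_of_lt hr n (by
      by_contra h
      push Not at h
      exact hx ⟨by linarith [neg_abs_le x, le_abs_self r], (le_abs_self x).trans (h.trans (le_abs_self r))⟩)

omit hc hs in
/-- Non-negativity of the rescaled power. -/
theorem cpowScaled_nonneg (hφ : ∀ x, 0 ≤ φ x) (n : ℕ) (x : ℝ) : 0 ≤ cpowScaled φ n x := by
  unfold cpowScaled
  exact mul_nonneg (by positivity) (cpow_nonneg hφ n _)

omit hc hs in
/-- Evenness of the rescaled power. -/
theorem cpowScaled_even (hφ : ∀ x, φ (-x) = φ x) (n : ℕ) (x : ℝ) :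
    cpowScaled φ n (-x) = cpowScaled φ n x := by
  unfold cpowScaled
  rw [mul_neg, cpow_even hφ]

omit hc hs in
/-- Fourier transform of a mass-preserving dilate: `𝓕 (x ↦ a f (a x)) (w) = 𝓕 f (w / a)` (`0 < a`). -/
theorem fourier_const_mul_comp_mul (f : ℝ → ℂ) {a : ℝ} (ha : 0 < a) (w : ℝ) :
    𝓕 (fun x : ℝ => (a : ℂ) * f (a * x)) w = 𝓕 f (w / a) := by
  rw [Real.fourier_real_eq, Real.fourier_real_eq]
  have key : (fun v : ℝ => 𝐞 (-(v * w)) • ((a : ℂ) * f (a * v)))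
      = fun v : ℝ => (a : ℂ) • ((fun y : ℝ => 𝐞 (-(y * (w / a))) • f y) (a * v)) := by
    funext v
    simp only [Circle.smul_def, smul_eq_mul]
    rw [show a * v * (w / a) = v * w by field_simp]
    ring
  rw [key, integral_smul, Measure.integral_comp_mul_left (fun y : ℝ => 𝐞 (-(y * (w / a))) • f y) a,
    Complex.real_smul, smul_eq_mul, ← mul_assoc, abs_of_pos (inv_pos.2 ha),
    show (a : ℂ) * ((a⁻¹ : ℝ) : ℂ) = 1 by
      rw [Complex.ofReal_inv, mul_inv_cancel₀ (Complex.ofReal_ne_zero.2 ha.ne')], one_mul]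

/-- `𝓕 ψ_n (ξ) = (𝓕 φ (ξ/(n+1)))^{n+1}`. -/
theorem fourier_cpowScaled (n : ℕ) (ξ : ℝ) :
    𝓕 (fun x => (cpowScaled φ n x : ℂ)) ξ
      = (𝓕 (fun x => (φ x : ℂ)) (ξ / (n + 1))) ^ (n + 1) := by
  have hn : (0 : ℝ) < n + 1 := by positivity
  have h1 : (fun x => (cpowScaled φ n x : ℂ))
      = fun x => ((n + 1 : ℝ) : ℂ) * (fun y : ℝ => (cpow φ n y : ℂ)) ((n + 1 : ℝ) * x) := by
    funext x
    simp only [cpowScaled]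
    push_cast
    ring
  rw [h1, fourier_const_mul_comp_mul (fun y : ℝ => (cpow φ n y : ℂ)) hn, fourier_cpow hc hs n]

end scaled

end Summit.RiemannHypothesis.RiemannHypothesis.Theorems
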